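import Mathlib
import Summits.SmoothPoincare4.SmoothPoincare4.Theorems.CylinderEntropySliceIsolationCertCheckAtoms
import HarnessLib

/-!
# Kernel certificate checker for `stub_certMid`, II: three more certified enclosures over `ℚ`

Infrastructure file 2 for the kernel-clean discharge of the registered stub `stub_certMid` of crux
stmt-SmoothPoincare4-7631 (`Summit.SmoothPoincare4.SmoothPoincare4.Theses.CylinderEntropy.CylinderRungTwo`, line `killing-flux`).
Three computable enclosures the second-order checker needs beyond `…CylinderEntropySliceIsolationCertArith/CertZonal`:

* `KCert.sqrtHi` — a dyadic UPPER bound of `√x` (`le_sqrtHi`), companion of `Cert.sqrtLo`;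
* `KCert.cosPair` — a two-sided dyadic enclosure of `cos t` for `t ∈ [0, π]` (`cosPair_spec`):
  `cos (t/2¹⁸)` from `Real.one_sub_sq_div_two_le_cos` / `Real.cos_bound`, then eighteen certified doublings
  `cos 2y = 2 cos² y - 1` (monotone while `cos y ≥ 0`, i.e. up to `y = t/2`), at `p + 40` working bits;
* `KCert.zonalStateRB` / `KCert.zonalPartialLoHiR` — the one-pass partial sums of the zonal series at
  `τ = -(log q)/2` rounded DOWN AND UP (the tree's `Cert.zonalStateR` gives only the lower side), whence the two-sided
  certified values `KCert.zlo ≤ zonal ≤ KCert.zhi` at a rational `s ∈ [-1, 1]` with the sharp geometric tail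
  (`zlo_zhi_spec`, `zlo_nonneg`).
Everything is [folklore]; no named facts.
-/

-- the registered namespace `Summit.SmoothPoincare4.SmoothPoincare4.…` repeats a component
set_option linter.dupNamespace false

namespace Summit.SmoothPoincare4.SmoothPoincare4.Cruxes.CylinderRungTwo.KillingFlux

namespace KCert

open Summit.SmoothPoincare4.SmoothPoincare4.Theorems.CylinderEntropySliceIsolation.Cert
open Literature.Geometry.Riemannian.SphericalCylinderEntropy
  Literature.Geometry.Riemannian.SphericalZonalKernelSeries

/-! ### An upper bound of `√x` -/

/-- **Upper bound of `√x`** to `p` fractional bits: `(Nat.sqrt ⌊x 4^p⌋₊ + 1) / 2^p`. [folklore] -/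
def sqrtHi (x : ℚ) (p : ℕ) : ℚ := ((Nat.sqrt ⌊x * 4 ^ p⌋₊ + 1 : ℕ) : ℚ) / 2 ^ p

/-- **`√x ≤ sqrtHi x p`** (any `x`; for `x < 0` the left side is `0`). [folklore] -/
theorem le_sqrtHi (x : ℚ) (p : ℕ) : Real.sqrt (x : ℝ) ≤ ((sqrtHi x p : ℚ) : ℝ) := by
  unfold sqrtHi
  have h4 : ((4 : ℝ) ^ p) = (2 ^ p) ^ 2 := by
    rw [← pow_mul, mul_comm, pow_mul]; norm_num
  have hpos : (0 : ℝ) < 2 ^ p := by positivity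
  rw [Real.sqrt_le_left (by positivity)]
  push_cast
  rw [div_pow, le_div_iff₀ (by positivity), ← h4]
  -- `x 4^p < ⌊x 4^p⌋₊ + 1 ≤ (sqrt n + 1)^2`
  have h1 : ((⌊x * 4 ^ p⌋₊ : ℕ) : ℝ) < (((Nat.sqrt ⌊x * 4 ^ p⌋₊ + 1 : ℕ) : ℝ)) ^ 2 := by
    exact_mod_cast Nat.lt_succ_sqrt' ⌊x * 4 ^ p⌋₊
  have h2 : (x : ℝ) * 4 ^ p < ((⌊x * 4 ^ p⌋₊ : ℕ) : ℝ) + 1 := by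
    have := Nat.lt_floor_add_one (x * 4 ^ p)
    have h' : ((x * 4 ^ p : ℚ) : ℝ) < (((⌊x * 4 ^ p⌋₊ : ℕ) : ℚ) : ℝ) + 1 := by exact_mod_cast this
    push_cast at h'
    exact h'
  have h3 : ((⌊x * 4 ^ p⌋₊ : ℕ) : ℝ) + 1 ≤ (((Nat.sqrt ⌊x * 4 ^ p⌋₊ + 1 : ℕ) : ℝ)) ^ 2 := by
    have : (⌊x * 4 ^ p⌋₊ : ℕ) + 1 ≤ (Nat.sqrt ⌊x * 4 ^ p⌋₊ + 1) ^ 2 := Nat.lt_succ_sqrt' _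
    exact_mod_cast this
  push_cast at h1 h3 ⊢
  linarith

/-! ### A two-sided enclosure of `cos` on `[0, π]` -/

/-- One certified doubling `cos 2y = 2cos²y - 1` of an enclosure `(lo, hi)` of `cos y ≥ 0`, with the new lower
end clamped at `0` (valid while `cos 2y ≥ 0`). [folklore] -/
def cosStepC (c : ℚ × ℚ) (P : ℕ) : ℚ × ℚ := (max 0 (rdn (2 * c.1 ^ 2 - 1) P), rup (2 * c.2 ^ 2 - 1) P)

/-- The last doubling (no clamp). [folklore] -/
def cosStepN (c : ℚ × ℚ) (P : ℕ) : ℚ × ℚ := (rdn (2 * c.1 ^ 2 - 1) P, rup (2 * c.2 ^ 2 - 1) P)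

/-- `n` clamped doublings. [folklore] -/
def cosIterC (c : ℚ × ℚ) (P : ℕ) : ℕ → ℚ × ℚ
  | 0 => c
  | n + 1 => cosStepC (cosIterC c P n) P

/-- **Two-sided enclosure of `cos t` for `t ∈ [0, π]`** to `p` fractional bits. [folklore] -/
def cosPair (t : ℚ) (p : ℕ) : ℚ × ℚ :=
  let P := p + 40
  let x := t / 2 ^ 18
  let c0 : ℚ × ℚ := (max 0 (rdn (1 - x ^ 2 / 2) P), rup (1 - x ^ 2 / 2 + 5 * x ^ 4 / 96) P)
  let c17 := cosIterC c0 P 17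
  let c18 := cosStepN c17 P
  (rdn c18.1 p, rup c18.2 p)

/-- The doubling algebra: `0 ≤ lo ≤ c ≤ hi` gives `2lo² - 1 ≤ 2c² - 1 ≤ 2hi² - 1`. [folklore] -/
theorem two_mul_sq_sub_one_bounds {lo hi c : ℝ} (h0 : 0 ≤ lo) (h1 : lo ≤ c) (h2 : c ≤ hi) :
    2 * lo ^ 2 - 1 ≤ 2 * c ^ 2 - 1 ∧ 2 * c ^ 2 - 1 ≤ 2 * hi ^ 2 - 1 := by
  have hc : 0 ≤ c := h0.trans h1
  constructor <;> nlinarith [pow_le_pow_left₀ h0 h1 2, pow_le_pow_left₀ hc h2 2]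

/-- `cos (t / 2^(k+1)) ≥ 0` for `0 ≤ t ≤ π`. [folklore] -/
theorem cos_div_pow_succ_nonneg {t : ℝ} (ht0 : 0 ≤ t) (htπ : t ≤ Real.pi) (k : ℕ) :
    0 ≤ Real.cos (t / 2 ^ (k + 1)) := by
  apply Real.cos_nonneg_of_neg_pi_div_two_le_of_le
  · have : 0 ≤ t / 2 ^ (k + 1) := by positivity
    linarith [Real.pi_pos]
  · rw [div_le_div_iff₀ (by positivity) (by norm_num)]
    have h2 : (2 : ℝ) ≤ 2 ^ (k + 1) := by
      calc (2 : ℝ) = 2 ^ 1 := by norm_num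
        _ ≤ 2 ^ (k + 1) := pow_le_pow_right₀ (by norm_num) (by omega)
    nlinarith [Real.pi_pos]

/-- Invariant of the clamped doublings: after `n ≤ 17` steps the pair encloses `cos (t / 2^(18-n))` and has a
nonnegative lower end. [folklore] -/
theorem cosIterC_spec {t : ℝ} (ht0 : 0 ≤ t) (htπ : t ≤ Real.pi) (c0 : ℚ × ℚ) (P : ℕ)
    (h0 : ((c0.1 : ℚ) : ℝ) ≤ Real.cos (t / 2 ^ 18) ∧ Real.cos (t / 2 ^ 18) ≤ ((c0.2 : ℚ) : ℝ) ∧ 0 ≤ c0.1) :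
    ∀ n, n ≤ 17 → ((cosIterC c0 P n).1 : ℝ) ≤ Real.cos (t / 2 ^ (18 - n)) ∧
      Real.cos (t / 2 ^ (18 - n)) ≤ ((cosIterC c0 P n).2 : ℝ) ∧ 0 ≤ (cosIterC c0 P n).1 := by
  intro n
  induction n with
  | zero => intro _; simpa [cosIterC] using h0
  | succ n ih =>
    intro hn
    obtain ⟨h1, h2, h3⟩ := ih (by omega)
    have hk : 18 - n = (17 - n) + 1 := by omega
    rw [hk] at h1 h2
    have hang : t / 2 ^ (17 - n) = 2 * (t / 2 ^ ((17 - n) + 1)) := by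
      rw [pow_succ]; field_simp
    have h3' : (0 : ℝ) ≤ ((cosIterC c0 P n).1 : ℝ) := by exact_mod_cast h3
    obtain ⟨hb1, hb2⟩ := two_mul_sq_sub_one_bounds h3' h1 h2
    have hnn : 0 ≤ Real.cos (t / 2 ^ (17 - n)) := by
      rw [show 17 - n = (16 - n) + 1 by omega]
      exact cos_div_pow_succ_nonneg ht0 htπ _
    rw [show 18 - (n + 1) = 17 - n by omega]
    simp only [cosIterC, cosStepC]
    refine ⟨?_, ?_, le_max_left _ _⟩
    · push_cast
      refine max_le hnn ?_
      rw [hang, Real.cos_two_mul]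
      refine (rdn_le_real _ _).trans ?_
      push_cast
      exact hb1
    · rw [hang, Real.cos_two_mul]
      refine le_trans ?_ (le_rup_real _ _)
      push_cast
      exact hb2

/-- **`(cosPair t p).1 ≤ cos t`** and **`cos t ≤ (cosPair t p).2`** for `0 ≤ t ≤ π`. [folklore] -/
theorem cosPair_spec {t : ℚ} (ht0 : 0 ≤ t) (htπ : (t : ℝ) ≤ Real.pi) (p : ℕ) :
    (((cosPair t p).1 : ℚ) : ℝ) ≤ Real.cos (t : ℝ) ∧ Real.cos (t : ℝ) ≤ (((cosPair t p).2 : ℚ) : ℝ) := by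
  have ht0' : (0 : ℝ) ≤ (t : ℝ) := by exact_mod_cast ht0
  have hxabs : |(t : ℝ) / 2 ^ 18| ≤ 1 := by
    rw [abs_of_nonneg (by positivity), div_le_one (by positivity)]
    linarith [Real.pi_lt_four]
  have hxr : (((t / 2 ^ 18 : ℚ)) : ℝ) = (t : ℝ) / 2 ^ 18 := by push_cast; ring
  have hc1 : ((max 0 (rdn (1 - (t / 2 ^ 18) ^ 2 / 2) (p + 40)) : ℚ) : ℝ) ≤ Real.cos ((t : ℝ) / 2 ^ 18) := by
    rw [Rat.cast_max]
    refine max_le ?_ ?_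
    · have := cos_div_pow_succ_nonneg ht0' htπ 17
      simpa using this
    · refine (rdn_le_real _ _).trans ?_
      have := Real.one_sub_sq_div_two_le_cos (x := (t : ℝ) / 2 ^ 18)
      push_cast
      exact this
  have hc2 : Real.cos ((t : ℝ) / 2 ^ 18) ≤
      ((rup (1 - (t / 2 ^ 18) ^ 2 / 2 + 5 * (t / 2 ^ 18) ^ 4 / 96) (p + 40) : ℚ) : ℝ) := by
    refine le_trans ?_ (le_rup_real _ _)
    have hcb := Real.cos_bound hxabs
    rw [abs_le] at hcb
    have habs4 : |(t : ℝ) / 2 ^ 18| ^ 4 = ((t : ℝ) / 2 ^ 18) ^ 4 := by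
      rw [abs_of_nonneg (by positivity)]
    push_cast
    linarith [hcb.2]
  have hc3 : (0 : ℚ) ≤ max 0 (rdn (1 - (t / 2 ^ 18) ^ 2 / 2) (p + 40)) := le_max_left _ _
  obtain ⟨h1, h2, h3⟩ := cosIterC_spec ht0' htπ
    (max 0 (rdn (1 - (t / 2 ^ 18) ^ 2 / 2) (p + 40)), rup (1 - (t / 2 ^ 18) ^ 2 / 2 + 5 * (t / 2 ^ 18) ^ 4 / 96) (p + 40))
    (p + 40) ⟨hc1, hc2, hc3⟩ 17 le_rfl
  rw [show (18 : ℕ) - 17 = 0 + 1 from rfl] at h1 h2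
  have hang : (t : ℝ) = 2 * ((t : ℝ) / 2 ^ (0 + 1)) := by ring
  set c17 := cosIterC
    (max 0 (rdn (1 - (t / 2 ^ 18) ^ 2 / 2) (p + 40)), rup (1 - (t / 2 ^ 18) ^ 2 / 2 + 5 * (t / 2 ^ 18) ^ 4 / 96) (p + 40))
    (p + 40) 17 with hc17
  have h3' : (0 : ℝ) ≤ ((c17.1 : ℚ) : ℝ) := by exact_mod_cast h3
  obtain ⟨hb1, hb2⟩ := two_mul_sq_sub_one_bounds h3' h1 h2
  show ((rdn (cosStepN c17 (p + 40)).1 p : ℚ) : ℝ) ≤ Real.cos (t : ℝ) ∧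
    Real.cos (t : ℝ) ≤ ((rup (cosStepN c17 (p + 40)).2 p : ℚ) : ℝ)
  simp only [cosStepN]
  constructor
  · refine (rdn_le_real _ _).trans ((rdn_le_real _ _).trans ?_)
    rw [hang, Real.cos_two_mul]
    push_cast
    exact hb1
  · refine le_trans (le_trans ?_ (le_rup_real _ _)) (le_rup_real _ _)
    rw [hang, Real.cos_two_mul]
    push_cast
    exact hb2

/-! ### Two-sided rounded partial sums of the zonal series -/

/-- The state of the two-sided rounded one-pass summation after `k` steps:
`(C_k(s), C_{k+1}(s), w⁻_k, w⁺_k, A⁻_k, A⁺_k)` with `w⁻_k ≤ q^{k(k+3)/2} ≤ w⁺_k` and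
`A⁻_k ≤ Σ_{j<k} q^{j(j+3)/2} (2j+3)/3 · C_j(s) ≤ A⁺_k` (`C_k` exact). [folklore] -/
def zonalStateRB (q s : ℚ) (p : ℕ) : ℕ → ℚ × ℚ × ℚ × ℚ × ℚ × ℚ
  | 0 => (1, 3 * s, 1, 1, 0, 0)
  | k + 1 =>
    let r := zonalStateRB q s p k
    let qk : ℚ := q ^ (k + 2)
    let t : ℚ := (2 * (k : ℚ) + 3) / 3 * r.1
    (r.2.1, ((2 * (k : ℚ) + 5) * s * r.2.1 - ((k : ℚ) + 3) * r.1) / ((k : ℚ) + 2),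
      dyadicDn (r.2.2.1 * qk) p, dyadicUp (r.2.2.2.1 * qk) p,
      dyadicDn (r.2.2.2.2.1 + if 0 ≤ t then r.2.2.1 * t else r.2.2.2.1 * t) p,
      dyadicUp (r.2.2.2.2.2 + if 0 ≤ t then r.2.2.2.1 * t else r.2.2.1 * t) p)

/-- Rounded lower and upper bounds of the partial sum `Σ_{k ≤ K} q^{k(k+3)/2} (2k+3)/3 · C_k(s)`. [folklore] -/
def zonalPartialLoHiR (q s : ℚ) (K p : ℕ) : ℚ × ℚ :=
  let r := zonalStateRB q s p (K + 1)
  (r.2.2.2.2.1, r.2.2.2.2.2)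

/-- The Gegenbauer components of the two-sided state are exact. [folklore] -/
theorem zonalStateRB_gegen (q s : ℚ) (p k : ℕ) :
    (zonalStateRB q s p k).1 = gegenQ k s ∧ (zonalStateRB q s p k).2.1 = gegenQ (k + 1) s := by
  induction k with
  | zero => exact ⟨rfl, rfl⟩
  | succ k ih =>
    rw [zonalStateRB]
    dsimp only
    rw [ih.1, ih.2, gegenQ_succ_succ]
    exact ⟨rfl, rfl⟩

/-- Invariant of the two-sided summation (`q ≥ 0`). [folklore] -/
theorem zonalStateRB_spec (q s : ℚ) (p : ℕ) (hq : 0 ≤ q) (k : ℕ) :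
    (zonalStateRB q s p k).2.2.1 ≤ q ^ (k * (k + 3) / 2) ∧
      q ^ (k * (k + 3) / 2) ≤ (zonalStateRB q s p k).2.2.2.1 ∧
      (zonalStateRB q s p k).2.2.2.2.1 ≤
        ∑ j ∈ Finset.range k, q ^ (j * (j + 3) / 2) * ((2 * (j : ℚ) + 3) / 3) * gegenQ j s ∧
      ∑ j ∈ Finset.range k, q ^ (j * (j + 3) / 2) * ((2 * (j : ℚ) + 3) / 3) * gegenQ j s ≤
        (zonalStateRB q s p k).2.2.2.2.2 := by
  induction k with
  | zero => simp [zonalStateRB]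
  | succ k ih =>
    obtain ⟨hlo, hhi, hacc, hacc'⟩ := ih
    have hc := (zonalStateRB_gegen q s p k).1
    rw [zonalStateRB]
    dsimp only
    refine ⟨(dyadicDn_le _ _).trans ?_, le_trans ?_ (le_dyadicUp _ _), (dyadicDn_le _ _).trans ?_,
      le_trans ?_ (le_dyadicUp _ _)⟩
    · rw [← half_mul_add_three_succ, pow_add q (k * (k + 3) / 2) (k + 2)]
      exact mul_le_mul_of_nonneg_right hlo (pow_nonneg hq _)
    · rw [← half_mul_add_three_succ, pow_add q (k * (k + 3) / 2) (k + 2)]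
      exact mul_le_mul_of_nonneg_right hhi (pow_nonneg hq _)
    · rw [Finset.sum_range_succ, hc]
      refine add_le_add hacc ?_
      rw [mul_assoc]
      split_ifs with ht
      · exact mul_le_mul_of_nonneg_right hlo ht
      · exact mul_le_mul_of_nonpos_right hhi (not_le.1 ht).le
    · rw [Finset.sum_range_succ, hc]
      refine add_le_add hacc' ?_
      rw [mul_assoc]
      split_ifs with ht
      · exact mul_le_mul_of_nonneg_right hhi ht
      · exact mul_le_mul_of_nonpos_right hlo (not_le.1 ht).le

/-- The two rounded partial sums bracket the exact one `Cert.zonalPartialQ`. [folklore] -/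
theorem zonalPartialLoHiR_spec (q s : ℚ) (K p : ℕ) (hq : 0 ≤ q) :
    (zonalPartialLoHiR q s K p).1 ≤ zonalPartialQ q s K ∧ zonalPartialQ q s K ≤ (zonalPartialLoHiR q s K p).2 := by
  rw [zonalPartialLoHiR, zonalPartialQ, zonalState_eq]
  exact ⟨(zonalStateRB_spec q s p hq (K + 1)).2.2.1, (zonalStateRB_spec q s p hq (K + 1)).2.2.2⟩

/-- **Certified lower value** of `zonal (-(log q)/2) s` (clamped at `0`): rounded partial sum minus the sharp tail.
[folklore] -/
def zlo (q s : ℚ) (K p : ℕ) : ℚ := max 0 ((zonalPartialLoHiR q s K p).1 - sharpTailQ q K)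

/-- **Certified upper value** of `zonal (-(log q)/2) s`: rounded partial sum plus the sharp tail. [folklore] -/
def zhi (q s : ℚ) (K p : ℕ) : ℚ := (zonalPartialLoHiR q s K p).2 + sharpTailQ q K

/-- `0 ≤ zlo`. [folklore] -/
theorem zlo_nonneg (q s : ℚ) (K p : ℕ) : 0 ≤ zlo q s K p := le_max_left _ _

/-- The sharp tail cast to `ℝ`. [folklore] -/
theorem sharpTailQ_cast (q : ℚ) (K : ℕ) :
    ((sharpTailQ q K : ℚ) : ℝ) =
      (q : ℝ) ^ ((K + 1) * (K + 4) / 2) * ((2 * (K : ℝ) + 5) * ((K : ℝ) + 2) * ((K : ℝ) + 3) / 6) /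
        (1 - (q : ℝ) ^ (K + 3) * ((2 * (K : ℝ) + 7) * ((K : ℝ) + 3) * ((K : ℝ) + 4)) /
          ((2 * (K : ℝ) + 5) * ((K : ℝ) + 2) * ((K : ℝ) + 3))) := by
  rw [sharpTailQ]; push_cast; ring

/-- **The certified two-sided values bracket the kernel**: at `s ∈ [-1, 1]` (`0 < q < 1`, sharp-tail ratio condition)
`zlo ≤ zonal(-(log q)/2, s) ≤ zhi` and `0 < zhi`. [folklore] -/
theorem zlo_zhi_spec {q s : ℚ} (K p : ℕ) (hq0 : 0 < q) (hq1 : q < 1) (hr : sharpOK q K = true)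
    (hs1 : -1 ≤ s) (hs2 : s ≤ 1) :
    ((zlo q s K p : ℚ) : ℝ) ≤ zonal (-(Real.log (q : ℝ)) / 2) (s : ℝ) ∧
      zonal (-(Real.log (q : ℝ)) / 2) (s : ℝ) ≤ ((zhi q s K p : ℚ) : ℝ) ∧ (0 : ℝ) < ((zhi q s K p : ℚ) : ℝ) := by
  have hq0' : (0 : ℝ) < (q : ℝ) := by exact_mod_cast hq0
  have hq1' : ((q : ℚ) : ℝ) < 1 := by exact_mod_cast hq1
  have hs : |((s : ℚ) : ℝ)| ≤ 1 := abs_le.2 ⟨by exact_mod_cast hs1, by exact_mod_cast hs2⟩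
  simp only [sharpOK, decide_eq_true_eq] at hr
  have hr' : ((q : ℚ) : ℝ) ^ (K + 3) * ((2 * (K : ℝ) + 7) * ((K : ℝ) + 3) * ((K : ℝ) + 4)) <
      (2 * (K : ℝ) + 5) * ((K : ℝ) + 2) * ((K : ℝ) + 3) := by exact_mod_cast hr
  have hlow := partialSum_sub_sharp_le_zonal hq0' hq1' K hs hr'
  have hupp := zonal_le_partialSum_add_sharp hq0' hq1' K hs hr'
  have hle1 : (((zonalPartialLoHiR q s K p).1 : ℚ) : ℝ) ≤ ((zonalPartialQ q s K : ℚ) : ℝ) := by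
    exact_mod_cast (zonalPartialLoHiR_spec q s K p hq0.le).1
  have hle2 : ((zonalPartialQ q s K : ℚ) : ℝ) ≤ (((zonalPartialLoHiR q s K p).2 : ℚ) : ℝ) := by
    exact_mod_cast (zonalPartialLoHiR_spec q s K p hq0.le).2
  rw [zonalPartialQ_cast] at hle1 hle2
  have hpos := zonal_pos (neg_log_div_two_pos hq0' hq1') ((s : ℚ) : ℝ) ⟨by exact_mod_cast hs1, by exact_mod_cast hs2⟩
  have h1 : ((zlo q s K p : ℚ) : ℝ) ≤ zonal (-(Real.log (q : ℝ)) / 2) (s : ℝ) := by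
    unfold zlo
    push_cast
    refine max_le hpos.le ?_
    rw [sharpTailQ_cast]
    linarith
  have h2 : zonal (-(Real.log (q : ℝ)) / 2) (s : ℝ) ≤ ((zhi q s K p : ℚ) : ℝ) := by
    unfold zhi
    push_cast
    rw [sharpTailQ_cast]
    linarith
  exact ⟨h1, h2, hpos.trans_le h2⟩

end KCert

/-- Registered sub-goal marker `stub_certMid_part2` of crux stmt-SmoothPoincare4-7631 (helper file 2/6 of the kernel-clean
`stub_certMid`, line killing-flux): the doubling algebra behind the certified cosine `KCert.cosPair`. [folklore] -/
theorem stub_certMid_part2 : ∀ (lo hi c : ℝ), 0 ≤ lo → lo ≤ c → c ≤ hi →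
    2 * lo ^ 2 - 1 ≤ 2 * c ^ 2 - 1 ∧ 2 * c ^ 2 - 1 ≤ 2 * hi ^ 2 - 1 :=
  fun _ _ _ h0 h1 h2 => KCert.two_mul_sq_sub_one_bounds h0 h1 h2

end Summit.SmoothPoincare4.SmoothPoincare4.Cruxes.CylinderRungTwo.KillingFlux
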